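import Mathlib
import Summits.CriticalPhenomena.CardyFormulaZ2.Theorems.CardyMagicRigidityNestingRigidityGapCrossing
import Summits.CriticalPhenomena.CardyFormulaZ2.Theorems.CardyMagicRigidityNestingRigidityBigLoopsTightT
import Summits.CriticalPhenomena.CardyFormulaZ2.Theorems.CardyMagicRigidityNestingRigidityFirstMomentIdentity
import Literature.Probability.Percolation.ClusterExtremalPoints
import HarnessLib

/-!
# Crux `NestingRigidity`, line `ring-cloud-tomography` (r5): the expected NUMBER of loops
# crossing an annulus (keystone K2) — summation lemma, bookkeeping, and the site-`𝕋` half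

Crux `Summit.CriticalPhenomena.CardyFormulaZ2.Theses.CardyMagicRigidity.NestingRigidity`
(stmt-CriticalPhenomena-4835), line `ring-cloud-tomography`, keystone helper K2 (the two-arm decay
of the EXPECTED NUMBER of loops meeting a small ball `B̄(x, a)` and leaving a big one `B(x, b)`,
the first-moment upgrade of the landed probability bound
`measure_exists_loop_cross_le_latticeEnsembles`, `…GapCrossing`).  This file proves, with no cited
fact and no definition:

* §1 **abstract summation** (`LoopCrossCount.integral_natCast_le_of_tails`, pure measure theory):
  for a measurable `ℕ`-valued statistic `N ≤ M` with `P(1 ≤ N) ≤ p` and a geometric tail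
  `P(2j + 2 ≤ N) ≤ A t^{4j}`, `E[N] ≤ p + 2√(pA)/(1 - t)` (layer cake
  `E[N] = ∑_k P(k + 1 ≤ N)`, `LoopCrossCount.integral_natCast_eq_sum_measureReal`, over the
  tree's `natCast_eq_sum_ite`, and
  `P(k + 1 ≤ N) ≤ min(p, A t^{4j}) ≤ √(pA) t^{k-2}`);
* §2 **bookkeeping on both lattices**: at fixed mesh the crossing count
  `#{u ∈ loops(X_δ) : trace u ∩ B̄(x,a) ≠ ∅, trace u ⊄ B(x,b)}` is finite and bounded by a
  deterministic constant (`FirstMoment.exists_ncard_loops_meeting_le`), measurable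
  (`FirstMoment.measurable_finsum_loops_sep`) and integrable;
* §3 **the geometric tail on `δ𝕋`** (`LoopCrossCount.measureReal_le_ncard_cross_tEns`): for
  `990 δ ≤ a`, `4a ≤ b`, `P(2j + 2 ≤ N) ≤ 2^{-α j}` — `2j + 2` distinct loops are interface loops
  with pairwise disjoint hexagon traces (`polyTrace_ne_of_unbasedLoop_ne`), each traversing
  `D(x; a, 4a)`, hence `j` disjoint confined open arms across `A(x; a + 9δ, 4a - 9δ)`
  (Aizenman–Burchard, `mem_disjointOccurrencePow_of_loops` of `LoopCrossingArms.lean`), an event of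
  probability `≤ (2^{-α})^j` by van den Berg–Kesten (`real_disjointOccurrencePow_le_pow`) and the
  Bollobás–Riordan annulus bound (`real_triArm_le`, `tri_annulusCrossing_bound_holds`);
* §4 **the site-`𝕋` half of K2** (anchor `integral_ncard_loops_cross_le_tEns`): `∃ c C c₀ > 0`,
  for `0 < δ`, `c₀ δ ≤ a`, `4a ≤ b`, the crossing count is integrable with expectation
  `≤ C (a/b)^c` (`c` = half the exponent of `GapCrossing.measure_loop_cross_le_tEns`).

Why the aspect-ratio hypothesis `4a ≤ b` (the registered K2 had `a < b`): without a lower bound on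
`b/a` the statement is FALSE — for `b = a + δ/100` every microscopic loop straddling the circle
`∂B(x, a)` is counted, and their expected number is of order `a/δ → ∞` as `δ → 0`, whereas
`C (a/b)^c ≤ C`.  Any fixed ratio `> 1` would do; `4` is what the tree's ratio-`2` RSW bounds give
after the `O(δ)` fattening of the lattice arms.
-/

noncomputable section

open MeasureTheory Set Filter Metric
open scoped Real Topology BigOperators ENNReal

namespace Summit.CriticalPhenomena.CardyFormulaZ2.Cruxes.NestingRigidity.RingCloudTomography

open Literature.Probability.RandomPlanarGeometry Literature.Probability.Percolation
  Literature.Probability.LatticeModels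
open Summit.CriticalPhenomena.CardyFormulaZ2.Cruxes.NestingRigidity.MarkovCascadeOneGeneration
  (exists_walk_of_mem_loops_siteLoopConfig range_mk_siteLoopCurve_eq_polyTrace
    polyTrace_ne_of_unbasedLoop_ne)

namespace LoopCrossCount

/-! ## §1 Abstract summation: a probability bound and a geometric tail bound the expectation -/

/-- **Layer-cake for a bounded measurable `ℕ`-valued statistic**:
`E[N] = ∑_{k < M} P(k + 1 ≤ N)` whenever `N ≤ M` surely. -/
theorem integral_natCast_eq_sum_measureReal {Ω : Type*} [MeasurableSpace Ω] (μ : Measure Ω)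
    [IsFiniteMeasure μ] {N : Ω → ℕ} (hN : Measurable fun ω ↦ (N ω : ℝ)) {M : ℕ}
    (hM : ∀ ω, N ω ≤ M) :
    ∫ ω, (N ω : ℝ) ∂μ = ∑ k ∈ Finset.range M, μ.real {ω | k + 1 ≤ N ω} := by
  have hmeas : ∀ k : ℕ, MeasurableSet {ω | k + 1 ≤ N ω} := fun k ↦ by
    have h := measurableSet_le (measurable_const (a := ((k + 1 : ℕ) : ℝ))) hN
    convert h using 2 with ω
    simp only [Nat.cast_le]
  have hfun : (fun ω ↦ (N ω : ℝ)) =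
      fun ω ↦ ∑ k ∈ Finset.range M, ({ω | k + 1 ≤ N ω}).indicator (fun _ ↦ (1 : ℝ)) ω := by
    funext ω
    rw [natCast_eq_sum_ite (hM ω)]
    refine Finset.sum_congr rfl fun k _ ↦ ?_
    simp only [Set.indicator_apply, Set.mem_setOf_eq]
  rw [hfun, integral_finsetSum _ fun k _ ↦ (integrable_const (1 : ℝ)).indicator (hmeas k)]
  refine Finset.sum_congr rfl fun k _ ↦ ?_
  rw [integral_indicator_const _ (hmeas k)]
  simp

/-- **Probability bound + geometric tail ⇒ expectation bound** (pure measure theory).  If a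
measurable `ℕ`-valued statistic `N ≤ M` satisfies `P(1 ≤ N) ≤ p` and
`P(2j + 2 ≤ N) ≤ A t^{4j}` for all `j` (`0 ≤ t < 1`), then
`E[N] ≤ p + 2 √(p A) / (1 - t)`: write `E[N] = ∑_{k ≥ 1} P(k ≤ N)` and bound the `k`-th term by
`min (p, A t^{4⌊(k-2)/2⌋}) ≤ √(p A) · t^{k - 3}`. -/
theorem integral_natCast_le_of_tails {Ω : Type*} [MeasurableSpace Ω] (μ : Measure Ω)
    [IsFiniteMeasure μ] {N : Ω → ℕ} (hN : Measurable fun ω ↦ (N ω : ℝ)) {M : ℕ}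
    (hM : ∀ ω, N ω ≤ M)
    {p A t : ℝ} (hp : 0 ≤ p) (hA : 0 ≤ A) (ht : 0 ≤ t) (ht1 : t < 1)
    (h1 : μ.real {ω | 1 ≤ N ω} ≤ p)
    (htail : ∀ j : ℕ, μ.real {ω | 2 * j + 2 ≤ N ω} ≤ A * t ^ (4 * j)) :
    ∫ ω, (N ω : ℝ) ∂μ ≤ p + 2 * Real.sqrt (p * A) / (1 - t) := by
  rw [integral_natCast_eq_sum_measureReal μ hN hM]
  -- the `k`-th term (`k ≥ 1`) is at most `√(p A) t^{k - 2}`, via `j = (k - 1) / 2`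
  have hterm : ∀ k : ℕ, 1 ≤ k → μ.real {ω | k + 1 ≤ N ω} ≤ Real.sqrt (p * A) * t ^ (k - 2) := by
    intro k hk
    set j : ℕ := (k - 1) / 2 with hj
    have hjk : 2 * j + 2 ≤ k + 1 := by omega
    have hle1 : μ.real {ω | k + 1 ≤ N ω} ≤ p :=
      (measureReal_mono (fun ω (hω : k + 1 ≤ N ω) ↦ show 1 ≤ N ω by omega)).trans h1
    have hle2 : μ.real {ω | k + 1 ≤ N ω} ≤ A * t ^ (4 * j) :=
      (measureReal_mono (fun ω (hω : k + 1 ≤ N ω) ↦ show 2 * j + 2 ≤ N ω by omega)).trans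
        (htail j)
    have hmin : μ.real {ω | k + 1 ≤ N ω} ≤ min p (A * t ^ (4 * j)) := le_min hle1 hle2
    have hgm : min p (A * t ^ (4 * j)) ≤ Real.sqrt (p * (A * t ^ (4 * j))) := by
      refine Real.le_sqrt_of_sq_le ?_
      rw [sq]
      exact mul_le_mul (min_le_left _ _) (min_le_right _ _) (le_min hp (by positivity)) hp
    refine hmin.trans (hgm.trans ?_)
    rw [show p * (A * t ^ (4 * j)) = (p * A) * (t ^ (2 * j)) ^ 2 by ring,
      Real.sqrt_mul (mul_nonneg hp hA), Real.sqrt_sq (by positivity)]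
    refine mul_le_mul_of_nonneg_left ?_ (Real.sqrt_nonneg _)
    exact pow_le_pow_of_le_one ht ht1.le (by omega)
  -- summing
  have ht1' : 0 < 1 - t := by linarith
  have hgeom : ∀ n : ℕ, ∑ i ∈ Finset.range n, t ^ i ≤ (1 - t)⁻¹ := fun n ↦ by
    rw [← tsum_geometric_of_lt_one ht ht1]
    exact (summable_geometric_of_lt_one ht ht1).sum_le_tsum _ (fun i _ ↦ pow_nonneg ht i)
  rcases Nat.eq_zero_or_pos M with rfl | hMpos
  · simp only [Finset.range_zero, Finset.sum_empty]
    positivity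
  rw [Finset.range_eq_Ico, ← Finset.sum_Ico_consecutive _ (Nat.zero_le 1) hMpos,
    show Finset.Ico 0 1 = {0} by rfl, Finset.sum_singleton]
  have hrest : ∑ k ∈ Finset.Ico 1 M, μ.real {ω | k + 1 ≤ N ω} ≤
      Real.sqrt (p * A) * (2 * (1 - t)⁻¹) := by
    calc ∑ k ∈ Finset.Ico 1 M, μ.real {ω | k + 1 ≤ N ω}
        ≤ ∑ k ∈ Finset.Ico 1 M, Real.sqrt (p * A) * t ^ (k - 2) :=
          Finset.sum_le_sum fun k hk ↦ hterm k (Finset.mem_Ico.1 hk).1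
      _ = Real.sqrt (p * A) * ∑ k ∈ Finset.Ico 1 M, t ^ (k - 2) := by rw [Finset.mul_sum]
      _ ≤ Real.sqrt (p * A) * (2 * (1 - t)⁻¹) := by
          refine mul_le_mul_of_nonneg_left ?_ (Real.sqrt_nonneg _)
          rw [Finset.sum_Ico_eq_sum_range]
          rcases Nat.eq_zero_or_pos (M - 1) with h0 | h0
          · rw [h0]; simp only [Finset.range_zero, Finset.sum_empty]; positivity
          rw [Finset.range_eq_Ico, ← Finset.sum_Ico_consecutive _ (Nat.zero_le 1) h0,
            show Finset.Ico 0 1 = {0} by rfl, Finset.sum_singleton, Finset.sum_Ico_eq_sum_range]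
          have h2 : ∑ k ∈ Finset.range (M - 1 - 1), t ^ (1 + (1 + k) - 2) =
              ∑ k ∈ Finset.range (M - 1 - 1), t ^ k :=
            Finset.sum_congr rfl fun k _ ↦ by congr 1; omega
          rw [h2]
          have h3 : t ^ (1 + 0 - 2) = 1 := by norm_num
          rw [h3]
          have h4 : (1 : ℝ) ≤ (1 - t)⁻¹ := by
            rw [le_inv_comm₀ one_pos ht1', inv_one]; linarith
          linarith [hgeom (M - 1 - 1)]
  have h0 : μ.real {ω | 0 + 1 ≤ N ω} ≤ p := by simpa using h1
  calc μ.real {ω | 0 + 1 ≤ N ω} + ∑ k ∈ Finset.Ico 1 M, μ.real {ω | k + 1 ≤ N ω}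
      ≤ p + Real.sqrt (p * A) * (2 * (1 - t)⁻¹) := add_le_add h0 hrest
    _ = p + 2 * Real.sqrt (p * A) / (1 - t) := by ring

/-! ## §2 The crossing count on both lattices: finite, bounded, measurable, integrable -/

/-- **At fixed mesh the crossing count is bounded by a deterministic constant** (both lattices):
the loops meeting `B̄(x, a)` meet `B̄(0, ‖x‖ + a)`, and only boundedly many loops do
(`FirstMoment.exists_ncard_loops_meeting_le`). -/
theorem exists_ncard_cross_le : ∀ E ∈ latticeEnsembles, ∀ {δ : ℝ}, 0 < δ → ∀ (x : ℂ) (a b : ℝ),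
    ∃ M : ℕ, ∀ ω : E.Ω,
      {u ∈ (E.X δ ω).loops | (u.range ∩ Metric.closedBall x a).Nonempty ∧
          (u.range ∩ (Metric.ball x b)ᶜ).Nonempty}.Finite ∧
        {u ∈ (E.X δ ω).loops | (u.range ∩ Metric.closedBall x a).Nonempty ∧
          (u.range ∩ (Metric.ball x b)ᶜ).Nonempty}.ncard ≤ M := by
  intro E hE δ hδ x a b
  obtain ⟨M, hM⟩ := FirstMoment.exists_ncard_loops_meeting_le E hE hδ (‖x‖ + a)
  refine ⟨M, fun ω ↦ ?_⟩
  obtain ⟨hfin, hle⟩ := hM ω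
  have hsub : {u ∈ (E.X δ ω).loops | (u.range ∩ Metric.closedBall x a).Nonempty ∧
      (u.range ∩ (Metric.ball x b)ᶜ).Nonempty} ⊆
      {u ∈ (E.X δ ω).loops | (u.range ∩ closedBall (0 : ℂ) (‖x‖ + a)).Nonempty} := by
    rintro u ⟨hu, ⟨z, hzu, hza⟩, -⟩
    refine ⟨hu, z, hzu, ?_⟩
    rw [mem_closedBall, dist_zero_right]
    rw [mem_closedBall] at hza
    calc ‖z‖ = dist z 0 := (dist_zero_right z).symm
      _ ≤ dist z x + dist x 0 := dist_triangle _ _ _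
      _ ≤ a + ‖x‖ := by rw [dist_zero_right]; linarith
      _ = ‖x‖ + a := add_comm _ _
  exact ⟨hfin.subset hsub, (Set.ncard_le_ncard hsub hfin).trans hle⟩

/-- **The crossing count is measurable** (both lattices; `#S = ∑ᶠ_{u ∈ S} 1` and
`FirstMoment.measurable_finsum_loops_sep`). -/
theorem measurable_ncard_cross : ∀ E ∈ latticeEnsembles, ∀ (δ : ℝ) (x : ℂ) (a b : ℝ),
    Measurable fun ω : E.Ω ↦
      ({u ∈ (E.X δ ω).loops | (u.range ∩ Metric.closedBall x a).Nonempty ∧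
          (u.range ∩ (Metric.ball x b)ᶜ).Nonempty}.ncard : ℝ) := by
  intro E hE δ x a b
  have h := FirstMoment.measurable_finsum_loops_sep E hE δ
    (fun u ↦ (u.range ∩ Metric.closedBall x a).Nonempty ∧ (u.range ∩ (Metric.ball x b)ᶜ).Nonempty)
    (fun _ ↦ (1 : ℝ))
  simp only [FirstMoment.finsum_mem_const_eq, mul_one] at h
  exact h

/-- **The crossing count is integrable** at every fixed mesh (both lattices). -/
theorem integrable_ncard_cross : ∀ E ∈ latticeEnsembles, ∀ {δ : ℝ}, 0 < δ → ∀ (x : ℂ) (a b : ℝ),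
    Integrable (fun ω : E.Ω ↦
      ({u ∈ (E.X δ ω).loops | (u.range ∩ Metric.closedBall x a).Nonempty ∧
          (u.range ∩ (Metric.ball x b)ᶜ).Nonempty}.ncard : ℝ)) E.P := by
  intro E hE δ hδ x a b
  haveI := isProbabilityMeasure_of_mem hE
  obtain ⟨M, hM⟩ := exists_ncard_cross_le E hE hδ x a b
  refine Integrable.of_bound (measurable_ncard_cross E hE δ x a b).aestronglyMeasurable M
    (Eventually.of_forall fun ω ↦ ?_)
  rw [Real.norm_eq_abs, Nat.abs_cast]
  exact_mod_cast (hM ω).2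

/-! ## §3 Site-`𝕋`: many crossing loops force many disjoint open arms -/

/-- **Deterministic core on `δ𝕋`.**  If `2j + 2` loops of `X_δ(ω) = siteLoopConfig δ ω` meet
`B̄(x, a)` and `ℂ ∖ B(x, b)` with `4a ≤ b`, `14 δ ≤ a`, then `ω` has `j` disjoint confined open
arms across `A(x; a + 9δ, 4a - 9δ)`: represent the loops by interface loops of `ω` with pairwise
distinct, hence pairwise disjoint, hexagon traces (`polyTrace_ne_of_unbasedLoop_ne`,
`IsSiteInterfaceLoop.polyTrace_eq_or_disjoint`), each traversing `D(x; a, 4a)`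
(`exists_pos_isTraversal`), and apply the several-loops Aizenman–Burchard lemma
`mem_disjointOccurrencePow_of_loops` (`LoopCrossingArms.lean`). -/
theorem mem_disjointOccurrencePow_of_le_ncard_cross_tEns {δ : ℝ} (hδ : 0 < δ) {x : ℂ} {a b : ℝ}
    (ha : 14 * δ ≤ a) (hab : 4 * a ≤ b) {j : ℕ} {ω : SiteConfig (Site 2)}
    (hω : 2 * j + 2 ≤ {u ∈ (tEns.X δ ω).loops | (u.range ∩ Metric.closedBall x a).Nonempty ∧
        (u.range ∩ (Metric.ball x b)ᶜ).Nonempty}.ncard) :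
    ω ∈ disjointOccurrencePow (triArm δ x (a + 9 * δ) (4 * a - 9 * δ)) j := by
  classical
  set S := {u ∈ (tEns.X δ ω).loops | (u.range ∩ Metric.closedBall x a).Nonempty ∧
        (u.range ∩ (Metric.ball x b)ᶜ).Nonempty} with hSdef
  have hSfin : S.Finite := Set.finite_of_ncard_pos (by omega)
  obtain ⟨t, htS, htcard⟩ := Set.exists_subset_encard_eq
    (show ((2 * j + 2 : ℕ) : ℕ∞) ≤ S.encard by rw [← hSfin.cast_ncard_eq]; exact_mod_cast hω)
  have htfin : t.Finite := hSfin.subset htS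
  have hcardT : htfin.toFinset.card = 2 * j + 2 := by
    have h := htfin.encard_eq_coe_toFinset_card
    rw [htcard] at h
    exact_mod_cast h.symm
  set e := (htfin.toFinset.equivFinOfCardEq hcardT).symm with he
  set u : Fin (2 * j + 2) → UnbasedLoop ℂ := fun i ↦ (e i : UnbasedLoop ℂ) with hudef
  have huS : ∀ i, u i ∈ S := fun i ↦ htS (htfin.mem_toFinset.1 (e i).2)
  have huinj : Function.Injective u := fun i i' h ↦ e.injective (Subtype.ext h)
  have hrep : ∀ i, ∃ (F : HexVertex) (γ : hexGraph.Walk F F), IsSiteInterfaceLoop ω γ ∧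
      UnbasedLoop.mk (BasedLoop.mk (siteLoopCurve δ γ) (isLoop_siteLoopCurve δ γ)) = u i :=
    fun i ↦ exists_walk_of_mem_loops_siteLoopConfig (huS i).1
  choose F γ hγ hγu using hrep
  have hrange : ∀ i, (u i).range = polyTrace δ (γ i) := fun i ↦ by
    rw [← hγu i]
    exact range_mk_siteLoopCurve_eq_polyTrace (hγ i)
  have hlen : ∀ i, 0 < (γ i).length := fun i ↦ by have := (hγ i).three_le_length; omega
  have ha0 : 0 < a := by linarith
  refine mem_disjointOccurrencePow_of_loops hδ (ρ := a) (R := 4 * a) ha0 le_rfl (by linarith)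
    le_rfl hγ (fun l l' hll' ↦ ?_) (fun l ↦ ?_)
  · refine ((hγ l).polyTrace_eq_or_disjoint hδ.ne' (hγ l')).resolve_left ?_
    refine polyTrace_ne_of_unbasedLoop_ne hδ.ne' (hγ _) (hγ _) ?_
    rw [hγu, hγu]
    exact fun h ↦ hll' (huinj h)
  · obtain ⟨-, ⟨z, hzu, hza⟩, ⟨z', hz'u, hz'b⟩⟩ := huS l
    rw [hrange, ← range_toCurve_eq_polyTrace (hlen l)] at hzu hz'u
    obtain ⟨u₁, rfl⟩ := hzu
    obtain ⟨u₂, rfl⟩ := hz'u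
    refine exists_pos_isTraversal δ (γ l) (by linarith : a < 4 * a) (u₁ := u₁) (u₂ := u₂)
      (mem_closedBall.1 hza) ?_
    have h4 : b ≤ dist ((γ l).toCurve (fun F ↦ (δ : ℂ) * hexCenter F) u₂) x :=
      not_lt.1 fun h ↦ hz'b (mem_ball.2 h)
    exact le_trans hab h4

/-- **Geometric tail of the crossing count on `δ𝕋`** (van den Berg–Kesten via
`real_disjointOccurrencePow_le_pow`, and the Bollobás–Riordan annulus bound in the form
`real_triArm_le`): with the exponent `α` of `tri_annulusCrossing_bound_holds`, for `990 δ ≤ a`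
and `4a ≤ b` the probability that at least `2j + 2` loops of `X_δ` meet `B̄(x, a)` and
`ℂ ∖ B(x, b)` is at most `(2^{-α})^j`. -/
theorem measureReal_le_ncard_cross_tEns {α : ℝ} (hα : 0 < α)
    (hbd : ∀ (c : Bool) (δ : ℝ) (z : ℂ) (r₁ r₂ : ℝ), 0 < δ → 1000 * δ ≤ r₁ → 2 * r₁ ≤ r₂ →
      (triSitePercolation half).real (triAnnulusCrossing c δ z r₁ r₂) ≤ (r₁ / r₂) ^ α)
    {δ : ℝ} (hδ : 0 < δ) (x : ℂ) {a b : ℝ} (ha : 990 * δ ≤ a) (hab : 4 * a ≤ b) (j : ℕ) :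
    tEns.P.real {ω | 2 * j + 2 ≤ {u ∈ (tEns.X δ ω).loops |
        (u.range ∩ Metric.closedBall x a).Nonempty ∧ (u.range ∩ (Metric.ball x b)ᶜ).Nonempty}.ncard} ≤
      ((1 / 2 : ℝ) ^ α) ^ j := by
  haveI : IsProbabilityMeasure tEns.P := isProbabilityMeasure_of_mem tEns_mem
  have hsub : {ω | 2 * j + 2 ≤ {u ∈ (tEns.X δ ω).loops |
        (u.range ∩ Metric.closedBall x a).Nonempty ∧ (u.range ∩ (Metric.ball x b)ᶜ).Nonempty}.ncard} ⊆
      disjointOccurrencePow (triArm δ x (a + 9 * δ) (4 * a - 9 * δ)) j := fun ω hω ↦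
    mem_disjointOccurrencePow_of_le_ncard_cross_tEns hδ (by linarith) hab hω
  refine (measureReal_mono hsub).trans ?_
  change (triSitePercolation half).real _ ≤ _
  obtain ⟨F, hF⟩ := exists_finset_determinedBy_triArm hδ x (a + 9 * δ) (4 * a - 9 * δ)
  rw [triSitePercolation_eq]
  refine (real_disjointOccurrencePow_le_pow half hF (isUpperSet_triArm δ x _ _) j).trans ?_
  rw [← triSitePercolation_eq]
  have h1 : (triSitePercolation half).real (triArm δ x (a + 9 * δ) (4 * a - 9 * δ)) ≤
      ((a + 9 * δ + δ) / (4 * a - 9 * δ - δ)) ^ α :=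
    real_triArm_le hbd hδ x (by linarith) (by linarith)
  have hden : 0 < 4 * a - 9 * δ - δ := by linarith
  have hratio : (a + 9 * δ + δ) / (4 * a - 9 * δ - δ) ≤ 1 / 2 := by
    rw [div_le_div_iff₀ hden (by norm_num)]; linarith
  have hnum : 0 ≤ (a + 9 * δ + δ) / (4 * a - 9 * δ - δ) :=
    div_nonneg (by linarith) hden.le
  have h2 : ((a + 9 * δ + δ) / (4 * a - 9 * δ - δ)) ^ α ≤ (1 / 2 : ℝ) ^ α :=
    Real.rpow_le_rpow hnum hratio hα.le
  exact pow_le_pow_left₀ measureReal_nonneg (h1.trans h2) j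

end LoopCrossCount

/-! ## §4 The expected number of crossing loops on site-`𝕋` -/

/-- **Two-arm decay of the expected NUMBER of loops of site-`𝕋` meeting a small ball and leaving a
big one.**  There are `c, C, c₀ > 0` such that for every centre `x`, mesh `δ > 0` and radii with
`c₀ δ ≤ a` and `4a ≤ b`, the number of loops of `X_δ = siteLoopConfig δ` whose trace meets both
`B̄(x, a)` and `ℂ ∖ B(x, b)` is integrable with expectation at most `C (a/b)^c`.  Proof: the
probability that there is at least one such loop is `≤ C₁ (a/b)^{c₁}`
(`GapCrossing.measure_loop_cross_le_tEns`), the probability that there are at least `2j + 2` is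
`≤ 2^{-α j}` uniformly (`LoopCrossCount.measureReal_le_ncard_cross_tEns`), and
`LoopCrossCount.integral_natCast_le_of_tails` sums the layer-cake formula with
`P(k ≤ N) ≤ min(C₁ (a/b)^{c₁}, 2^{-α j})`; `c = c₁ / 2`.  (The aspect ratio `4` is what the tree's
ratio-`2` RSW bound gives after the `O(δ)` fattening of the arms; without a lower bound on
`b / a` the statement is false: the count of loops straddling a fixed circle diverges as
`δ → 0`.) -/
theorem integral_ncard_loops_cross_le_tEns : ∃ c C c₀ : ℝ, 0 < c ∧ 0 < C ∧ 0 < c₀ ∧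
    ∀ (x : ℂ) (a b δ : ℝ), 0 < δ → c₀ * δ ≤ a → 4 * a ≤ b →
      Integrable (fun ω ↦ ({u ∈ (tEns.X δ ω).loops | (u.range ∩ Metric.closedBall x a).Nonempty ∧
        (u.range ∩ (Metric.ball x b)ᶜ).Nonempty}.ncard : ℝ)) tEns.P ∧
      ∫ ω, ({u ∈ (tEns.X δ ω).loops | (u.range ∩ Metric.closedBall x a).Nonempty ∧
        (u.range ∩ (Metric.ball x b)ᶜ).Nonempty}.ncard : ℝ) ∂tEns.P ≤ C * (a / b) ^ c := by
  haveI : IsProbabilityMeasure tEns.P := isProbabilityMeasure_of_mem tEns_mem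
  obtain ⟨c₁, C₁, k₁, hc₁, hC₁, hk₁, hP⟩ := GapCrossing.measure_loop_cross_le_tEns
  obtain ⟨α, hα, hbd⟩ := tri_annulusCrossing_bound_holds
  set t : ℝ := (1 / 2 : ℝ) ^ (α / 4) with ht
  have ht0 : 0 ≤ t := by positivity
  have ht1 : t < 1 := Real.rpow_lt_one (by norm_num) (by norm_num) (by positivity)
  have htpow : ∀ j : ℕ, ((1 / 2 : ℝ) ^ α) ^ j = t ^ (4 * j) := fun j ↦ by
    rw [ht, ← Real.rpow_natCast, ← Real.rpow_natCast, ← Real.rpow_mul (by norm_num),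
      ← Real.rpow_mul (by norm_num)]
    congr 1
    push_cast
    ring
  refine ⟨c₁ / 2, C₁ + 2 * Real.sqrt C₁ / (1 - t), max k₁ 990, by positivity, ?_, by positivity,
    fun x a b δ hδ ha hab ↦ ?_⟩
  · have : 0 < 2 * Real.sqrt C₁ / (1 - t) := by
      have := Real.sqrt_pos.2 hC₁
      have : 0 < 1 - t := by linarith
      positivity
    linarith
  have hk₁a : k₁ * δ ≤ a := le_trans (mul_le_mul_of_nonneg_right (le_max_left _ _) hδ.le) ha
  have h990 : 990 * δ ≤ a := le_trans (mul_le_mul_of_nonneg_right (le_max_right _ _) hδ.le) ha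
  have ha0 : 0 < a := by linarith
  have hb0 : 0 < b := by linarith
  have hr0 : 0 ≤ a / b := by positivity
  have hr1 : a / b ≤ 1 := by rw [div_le_one hb0]; linarith
  refine ⟨LoopCrossCount.integrable_ncard_cross tEns tEns_mem hδ x a b, ?_⟩
  obtain ⟨M, hM⟩ := LoopCrossCount.exists_ncard_cross_le tEns tEns_mem hδ x a b
  -- the two inputs of the summation lemma
  set p : ℝ := C₁ * (a / b) ^ c₁ with hp
  have hp0 : 0 ≤ p := by positivity
  have h1 : tEns.P.real {ω | 1 ≤ {u ∈ (tEns.X δ ω).loops | (u.range ∩ Metric.closedBall x a).Nonempty ∧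
      (u.range ∩ (Metric.ball x b)ᶜ).Nonempty}.ncard} ≤ p := by
    have hsub : {ω | 1 ≤ {u ∈ (tEns.X δ ω).loops | (u.range ∩ Metric.closedBall x a).Nonempty ∧
        (u.range ∩ (Metric.ball x b)ᶜ).Nonempty}.ncard} ⊆
        {ω | ∃ u ∈ (tEns.X δ ω).loops, (u.range ∩ closedBall x a).Nonempty ∧
          (u.range ∩ (ball x b)ᶜ).Nonempty} := by
      intro ω hω
      obtain ⟨u, hu⟩ := Set.nonempty_of_ncard_ne_zero (Nat.one_le_iff_ne_zero.1 hω)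
      exact ⟨u, hu.1, hu.2⟩
    refine (measureReal_mono hsub).trans ?_
    exact ENNReal.toReal_le_of_le_ofReal hp0 (hP x a b δ hδ hk₁a hb0)
  have htail : ∀ j : ℕ, tEns.P.real {ω | 2 * j + 2 ≤ {u ∈ (tEns.X δ ω).loops |
      (u.range ∩ Metric.closedBall x a).Nonempty ∧ (u.range ∩ (Metric.ball x b)ᶜ).Nonempty}.ncard} ≤
      1 * t ^ (4 * j) := fun j ↦ by
    rw [one_mul, ← htpow]
    exact LoopCrossCount.measureReal_le_ncard_cross_tEns hα hbd hδ x h990 hab j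
  have hmain := LoopCrossCount.integral_natCast_le_of_tails tEns.P
    (LoopCrossCount.measurable_ncard_cross tEns tEns_mem δ x a b) (fun ω ↦ (hM ω).2) hp0 zero_le_one
    ht0 ht1 h1 htail
  rw [mul_one] at hmain
  refine hmain.trans ?_
  -- `p + 2 √p / (1 - t) ≤ (C₁ + 2 √C₁ / (1 - t)) (a/b)^{c₁/2}`
  have hhalf : (a / b) ^ c₁ = ((a / b) ^ (c₁ / 2)) ^ 2 := by
    rw [← Real.rpow_natCast, ← Real.rpow_mul hr0]; congr 1; push_cast; ring
  have hs0 : 0 ≤ (a / b) ^ (c₁ / 2) := by positivity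
  have hs1 : (a / b) ^ (c₁ / 2) ≤ 1 := Real.rpow_le_one hr0 hr1 (by positivity)
  have hsqrt : Real.sqrt p = Real.sqrt C₁ * (a / b) ^ (c₁ / 2) := by
    rw [hp, hhalf, Real.sqrt_mul hC₁.le, Real.sqrt_sq hs0]
  have hple : p ≤ C₁ * (a / b) ^ (c₁ / 2) := by
    rw [hp, hhalf, sq, ← mul_assoc]
    exact mul_le_of_le_one_right (by positivity) hs1
  have h1t : 0 < 1 - t := by linarith
  rw [hsqrt]
  calc p + 2 * (Real.sqrt C₁ * (a / b) ^ (c₁ / 2)) / (1 - t)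
      ≤ C₁ * (a / b) ^ (c₁ / 2) + 2 * (Real.sqrt C₁ * (a / b) ^ (c₁ / 2)) / (1 - t) := by
        linarith
    _ = (C₁ + 2 * Real.sqrt C₁ / (1 - t)) * (a / b) ^ (c₁ / 2) := by
        field_simp

end Summit.CriticalPhenomena.CardyFormulaZ2.Cruxes.NestingRigidity.RingCloudTomography

end
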